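import Mathlib
import Summits.Ventures.PercRepro2.UniversalTransport
import Summits.Ventures.PercRepro2.CascadeFin

/-! # The series of bundles `B_{m 0} ∧ … ∧ B_{m n}`: configuration cube, labels and the three rules
(seat mine-b, cell pub-perc-repro2; MINE-B.md §24)

The configuration cube of `n + 1` bundles of `m t` free edges in series is the dependent product
`(t : Fin (n+1)) → Finset (Fin (m t))` (the sets of blue edges), with the labels
`sbR x = min_t (m t − |x t|)` and `sbB x = min_t |x t|` (the red and the blue max-flow).  A source
(`sbR = 0`, `sbB ≥ 1`) has a full bundle and no empty one; its demand is `d = sbB x`.  The universal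
level-conditioned Hall assignment (UH*) of MINE-B.md §18.1(a) is given by THREE rules, read off the
level `d` and the shape of the non-full bundles:

* `d ≥ 2` (`ruleTheta`): every full bundle loses the slot's element `i` (exactly one red edge), every
  non-full bundle is moved by the cascade map of CascadeFin.lean, which never leaves a bundle with
  exactly one red edge — so the bundles of the target with exactly one red edge are EXACTLY the
  formerly full ones, the slot is their common missing element, and the cascade is injective;
* `d = 1` with a non-full bundle of exactly one red edge (`ruleEmpty`): the full bundles are emptied
  (a source has no empty bundle, so the target decodes the full set); the one-red bundle is the flag;
* `d = 1` otherwise (`ruleTwo`): the full bundles lose the element `2` (one full bundle) or `0` at the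
  first and `1` at the other full bundles; the pattern of missing elements is never the one of
  `ruleTheta`, and the target keeps a bundle of one blue edge.

This file holds the definitions and the bundle-by-bundle facts about the rules; the validity, the
injectivity and the theorem `universal_seriesBundles` are in UniversalSeriesBundles.lean. -/

namespace Summit.Ventures.PercRepro2.UHClosure

open Finset

section seriesBundles

variable {n : ℕ} (m : Fin (n + 1) → ℕ)

/-- the configuration cube of the series of bundles: the sets of blue edges, bundle by bundle -/
abbrev SBConf : Type := (t : Fin (n + 1)) → Finset (Fin (m t))

/-- the red label: the least number of red edges over the bundles (the red max-flow) -/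
def sbR (x : SBConf m) : ℕ := univ.inf' univ_nonempty (fun t => m t - (x t).card)

/-- the blue label: the least number of blue edges over the bundles (the blue max-flow) -/
def sbB (x : SBConf m) : ℕ := univ.inf' univ_nonempty (fun t => (x t).card)

/-- `[m t] ∖ {i}`, as a filter so that no bound on `i` enters the definition -/
def uErase (t : Fin (n + 1)) (i : ℕ) : Finset (Fin (m t)) := univ.filter (fun j => j.val ≠ i)

variable {m}

/-- the red label is below every bundle's red count -/
lemma sbR_le (x : SBConf m) (t : Fin (n + 1)) : sbR m x ≤ m t - (x t).card :=
  Finset.inf'_le _ (mem_univ t)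

/-- a uniform lower bound on the red counts bounds the red label -/
lemma le_sbR {x : SBConf m} {k : ℕ} (h : ∀ t, k ≤ m t - (x t).card) : k ≤ sbR m x :=
  Finset.le_inf' _ _ (fun t _ => h t)

/-- the blue label is below every bundle's blue count -/
lemma sbB_le (x : SBConf m) (t : Fin (n + 1)) : sbB m x ≤ (x t).card :=
  Finset.inf'_le _ (mem_univ t)

/-- a uniform lower bound on the blue counts bounds the blue label -/
lemma le_sbB {x : SBConf m} {k : ℕ} (h : ∀ t, k ≤ (x t).card) : k ≤ sbB m x :=
  Finset.le_inf' _ _ (fun t _ => h t)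

/-- the red label is attained -/
lemma exists_sbR_eq (x : SBConf m) : ∃ t, m t - (x t).card = sbR m x := by
  obtain ⟨t, -, h⟩ :=
    Finset.exists_mem_eq_inf' (univ_nonempty (α := Fin (n + 1))) (fun t => m t - (x t).card)
  exact ⟨t, h.symm⟩

/-- the blue label is attained -/
lemma exists_sbB_eq (x : SBConf m) : ∃ t, (x t).card = sbB m x := by
  obtain ⟨t, -, h⟩ :=
    Finset.exists_mem_eq_inf' (univ_nonempty (α := Fin (n + 1))) (fun t => (x t).card)
  exact ⟨t, h.symm⟩

/-- a bundle has at most `m t` blue edges -/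
lemma card_le_m (x : SBConf m) (t : Fin (n + 1)) : (x t).card ≤ m t := by
  have := Finset.card_le_univ (x t); rwa [Fintype.card_fin] at this

/-- a bundle is full iff it has `m t` blue edges -/
lemma eq_univ_iff_card (x : SBConf m) (t : Fin (n + 1)) : x t = univ ↔ (x t).card = m t := by
  rw [← Finset.card_eq_iff_eq_univ, Fintype.card_fin]

/-- a source has a full bundle and no empty one -/
lemma sb_src {x : SBConf m} (h : USrc (sbR m) (sbB m) x) :
    (∃ t, x t = univ) ∧ ∀ t, 1 ≤ (x t).card := by
  obtain ⟨h1, h2⟩ := h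
  refine ⟨?_, fun t => le_trans h2 (sbB_le x t)⟩
  obtain ⟨t, ht⟩ := exists_sbR_eq x
  refine ⟨t, (eq_univ_iff_card x t).2 ?_⟩
  have := card_le_m x t; omega

/-- `sbR = 1` from "every bundle non-full, some bundle with exactly one red edge" -/
lemma sbR_eq_one {y : SBConf m} (h1 : ∀ t, (y t).card < m t) (h2 : ∃ t, (y t).card + 1 = m t) :
    sbR m y = 1 := by
  apply le_antisymm
  · obtain ⟨t, ht⟩ := h2; have := sbR_le y t; omega
  · exact le_sbR (fun t => by have := h1 t; omega)

/-- membership in `uErase` -/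
lemma mem_uErase {t : Fin (n + 1)} {i : ℕ} {j : Fin (m t)} : j ∈ uErase m t i ↔ j.val ≠ i := by
  simp [uErase]

/-- `uErase` removes exactly one edge when `i < m t` -/
lemma card_uErase {t : Fin (n + 1)} {i : ℕ} (hi : i < m t) : (uErase m t i).card + 1 = m t := by
  have : uErase m t i = univ.erase ⟨i, hi⟩ := by
    ext j; simp [uErase, Fin.ext_iff]
  rw [this, Finset.card_erase_of_mem (mem_univ _), card_univ, Fintype.card_fin]; omega

/-- `uErase` determines the removed element -/
lemma uErase_inj {t : Fin (n + 1)} {i i' : ℕ} (hi' : i' < m t)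
    (h : uErase m t i = uErase m t i') : i = i' := by
  by_contra hne
  have : (⟨i', hi'⟩ : Fin (m t)) ∈ uErase m t i := mem_uErase.2 (Ne.symm hne)
  rw [h] at this
  exact (mem_uErase.1 this) rfl

/-- rule (θ): a full bundle loses the slot's element, a non-full bundle is cascaded -/
def ruleTheta (i : ℕ) (x : SBConf m) : SBConf m :=
  fun t => if x t = univ then uErase m t i else cascade (x t)

/-- rule (∅): the full bundles are emptied -/
def ruleEmpty (x : SBConf m) : SBConf m := fun t => if x t = univ then ∅ else x t

/-- the full bundles of a configuration -/
def fullSet (x : SBConf m) : Finset (Fin (n + 1)) := univ.filter (fun t => x t = univ)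

/-- membership in the full set -/
lemma mem_fullSet {x : SBConf m} {t : Fin (n + 1)} : t ∈ fullSet x ↔ x t = univ := by
  simp [fullSet]

/-- the element removed by rule (2) from a full bundle: `2` if there is one full bundle, else `0` at
the first full bundle and `1` at the others -/
def twoElt (x : SBConf m) (t : Fin (n + 1)) : ℕ :=
  if (fullSet x).card = 1 then 2
  else if h : (fullSet x).Nonempty then (if t = (fullSet x).min' h then 0 else 1) else 0

/-- the removed element is `0`, `1` or `2` -/
lemma twoElt_lt_three (x : SBConf m) (t : Fin (n + 1)) : twoElt x t < 3 := by
  unfold twoElt; split_ifs <;> omega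

/-- rule (2): a full bundle loses `twoElt`, the others stay -/
def ruleTwo (x : SBConf m) : SBConf m :=
  fun t => if x t = univ then uErase m t (twoElt x t) else x t

/-- some bundle has exactly one red edge -/
def HasOneRed (x : SBConf m) : Prop := ∃ t, (x t).card + 1 = m t

/-- `HasOneRed` is decidable (a search over the bundles) -/
instance (x : SBConf m) : Decidable (HasOneRed x) := by unfold HasOneRed; infer_instance

/-- the assignment of (UH*) on the series of bundles: rule (θ) at level `≥ 2`, rule (∅) at level `1`
with a one-red non-full bundle, rule (2) otherwise -/
def sbAssign (q : SlotL (USrc (sbR m) (sbB m)) (sbB m)) : SBConf m :=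
  if 2 ≤ sbB m q.1.1.1 then ruleTheta q.1.2.val q.1.1.1
  else if HasOneRed q.1.1.1 then ruleEmpty q.1.1.1
  else ruleTwo q.1.1.1

section rules

variable {x : SBConf m} {i : ℕ}

/-- rule (θ) at a full bundle -/
lemma ruleTheta_of_full {t : Fin (n + 1)} (h : x t = univ) : ruleTheta i x t = uErase m t i := by
  simp [ruleTheta, h]

/-- rule (θ) at a non-full bundle -/
lemma ruleTheta_of_not_full {t : Fin (n + 1)} (h : x t ≠ univ) :
    ruleTheta i x t = cascade (x t) := by
  simp [ruleTheta, h]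

/-- rule (∅) at a full bundle -/
lemma ruleEmpty_of_full {t : Fin (n + 1)} (h : x t = univ) : ruleEmpty x t = ∅ := by
  simp [ruleEmpty, h]

/-- rule (∅) at a non-full bundle -/
lemma ruleEmpty_of_not_full {t : Fin (n + 1)} (h : x t ≠ univ) : ruleEmpty x t = x t := by
  simp [ruleEmpty, h]

/-- rule (2) at a full bundle -/
lemma ruleTwo_of_full {t : Fin (n + 1)} (h : x t = univ) :
    ruleTwo x t = uErase m t (twoElt x t) := by
  simp [ruleTwo, h]

/-- rule (2) at a non-full bundle -/
lemma ruleTwo_of_not_full {t : Fin (n + 1)} (h : x t ≠ univ) : ruleTwo x t = x t := by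
  simp [ruleTwo, h]

/-- a non-full bundle has fewer than `m t` blue edges -/
lemma card_lt_of_not_full {t : Fin (n + 1)} (h : x t ≠ univ) : (x t).card < m t := by
  have := card_le_m x t
  have h3 : (x t).card ≠ m t := fun e => h ((eq_univ_iff_card x t).2 e)
  omega

/-- rule (θ) leaves every bundle non-full -/
lemma ruleTheta_card_lt (hi : ∀ t, i < m t) (t : Fin (n + 1)) : (ruleTheta i x t).card < m t := by
  by_cases h : x t = univ
  · rw [ruleTheta_of_full h]; have := card_uErase (m := m) (hi t); omega
  · rw [ruleTheta_of_not_full h]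
    have h1 := Finset.card_le_card (cascade_subset (x t))
    have h2 := card_lt_of_not_full h
    omega

/-- under rule (θ) a bundle has exactly one red edge iff it was full -/
lemma ruleTheta_oneRed_iff (hi : ∀ t, i < m t) (h2 : ∀ t, 2 ≤ (x t).card) (t : Fin (n + 1)) :
    (ruleTheta i x t).card + 1 = m t ↔ x t = univ := by
  by_cases h : x t = univ
  · simp only [h, iff_true]; rw [ruleTheta_of_full h]; exact card_uErase (hi t)
  · simp only [h, iff_false]; rw [ruleTheta_of_not_full h]
    have h4 := card_lt_of_not_full h
    exact card_cascade_add_one_ne (h2 t) (by omega)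

/-- rule (θ) lowers every blue count by at most one -/
lemma ruleTheta_card_ge (hi : ∀ t, i < m t) {d : ℕ} (hd : ∀ t, d ≤ (x t).card) (t : Fin (n + 1)) :
    d ≤ (ruleTheta i x t).card + 1 := by
  by_cases h : x t = univ
  · rw [ruleTheta_of_full h, card_uErase (hi t)]; have := hd t; have := card_le_m x t; omega
  · rw [ruleTheta_of_not_full h]; have := card_le_card_cascade_add_one (x t); have := hd t; omega

/-- under rule (∅) a bundle is empty iff it was full -/
lemma ruleEmpty_eq_empty_iff (h1 : ∀ t, 1 ≤ (x t).card) (t : Fin (n + 1)) :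
    ruleEmpty x t = ∅ ↔ x t = univ := by
  by_cases h : x t = univ
  · simp only [h, iff_true]; exact ruleEmpty_of_full h
  · simp only [h, iff_false]; rw [ruleEmpty_of_not_full h]
    intro e; have := h1 t; rw [e, card_empty] at this; omega

/-- under rule (2) a bundle has exactly one red edge iff it was full -/
lemma ruleTwo_oneRed_iff (hm : ∀ t, 3 ≤ m t) (hnor : ¬ HasOneRed x) (t : Fin (n + 1)) :
    (ruleTwo x t).card + 1 = m t ↔ x t = univ := by
  by_cases h : x t = univ
  · simp only [h, iff_true]; rw [ruleTwo_of_full h]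
    exact card_uErase (lt_of_lt_of_le (twoElt_lt_three x t) (hm t))
  · simp only [h, iff_false]; rw [ruleTwo_of_not_full h]
    exact fun e => hnor ⟨t, e⟩

/-- rule (2) leaves every bundle nonempty -/
lemma ruleTwo_card_pos (hm : ∀ t, 3 ≤ m t) (h1 : ∀ t, 1 ≤ (x t).card) (t : Fin (n + 1)) :
    1 ≤ (ruleTwo x t).card := by
  by_cases h : x t = univ
  · rw [ruleTwo_of_full h]
    have := card_uErase (m := m) (t := t) (lt_of_lt_of_le (twoElt_lt_three x t) (hm t))
    have := hm t; omega
  · rw [ruleTwo_of_not_full h]; exact h1 t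

/-- rule (2) leaves every bundle non-full -/
lemma ruleTwo_card_lt (hm : ∀ t, 3 ≤ m t) (t : Fin (n + 1)) : (ruleTwo x t).card < m t := by
  by_cases h : x t = univ
  · rw [ruleTwo_of_full h]
    have := card_uErase (m := m) (t := t) (lt_of_lt_of_le (twoElt_lt_three x t) (hm t)); omega
  · rw [ruleTwo_of_not_full h]; exact card_lt_of_not_full h

end rules


end seriesBundles

end Summit.Ventures.PercRepro2.UHClosure
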